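import Summits.AtomisticToContinuum.Crystallization.Theorems.UniformPolytypeStability.Negative.Rows
import Summits.AtomisticToContinuum.Crystallization.Theorems.UniformPolytypeStability.Negative.HaggLattice

/-!
# `UniformPolytypeStability` (stmt-AtomisticToContinuum-15800), negative side V-b: the Hägg condition is load-bearing

Part V-b of the standing disprover's load-bearing analysis of crux `UniformPolytypeStability`
(route `DisclinationRation`).  MAIN RESULT `uniformPolytypeStability_false_without_hagg`: on the
window `47/50 ≤ a ≤ 1 ∧ HeightBox a z` with the hypothesis `IsHaggSeq s` DELETED, uniform
polytype stability is FALSE — any proof of the crux must use that the word has letters `±1`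
(no two adjacent layers in the same registry).  Witness (part V-a): the AAA stacking `s ≡ 0`,
`a₀ = 47/50`, heights `h₀m`, `h₀ = 39a₀/50`; it is force balanced (Bravais, part I) and for
`u = e₁·𝟙_{0}` part II gives `½·hessForm = Σ_{y ≠ 0} e₁ᵀK(y)e₁`, which is NEGATIVE: the near
field `|n|_∞ ≤ 2` is `< −75.8` exactly (part V-a, kernel arithmetic over `ℚ`), and the far field
is `≤ q⁻⁴ ≤` the sum of three slab majorants `(16/9a₀⁴)·i⁻⁴·w(j)·w′(m)` (+ the two symmetric
ones), `w(j) = (4/3a₀²)j⁻²`, `w′(m) = h₀⁻²m⁻²` (`1` at `0`), summed in closed form with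
`ζ(2) = π²/6`, `Σ_{|n|≥3} n⁻⁴ ≤ 0.063` (part IV-a) and `π < 3.15`: `≤ 21`.  Hence
`½·hessForm < −54 < 0 ≤ κ·nnForm`.  All `[folklore]`.
-/

noncomputable section

namespace Summit.AtomisticToContinuum.Crystallization.Theorems.UniformPolytypeStabilityNegative

open scoped BigOperators Topology Classical InnerProductSpace
open Filter Set Function Real
open Literature.MathematicalPhysics.StatisticalMechanics
open Summit.AtomisticToContinuum.Crystallization.Theorems.PhononStabilityNegative

local notation "E3" => EuclideanSpace ℝ (Fin 3)

section HaggFar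

/-! ### The far field: three slab majorants -/

/-- Quadratic weight `w_c(n) = c·n⁻²` off the origin, `1` at the origin. [folklore] -/
def w2 (c : ℝ) (n : ℤ) : ℝ := if n = 0 then 1 else c * ((n : ℝ) ^ 2)⁻¹

/-- `w_c ≥ 0` for `c ≥ 0`. [folklore] -/
theorem w2_nonneg {c : ℝ} (hc : 0 ≤ c) (n : ℤ) : 0 ≤ w2 c n := by
  unfold w2; split_ifs <;> positivity

/-- `Σ_{n∈ℤ} w_c(n) = 1 + 2c·π²/6`. [folklore] -/
theorem hasSum_w2 (c : ℝ) : HasSum (w2 c) (1 + 2 * c * (π ^ 2 / 6)) := by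
  have hA : HasSum (fun n : ℕ => w2 c n) (c * (π ^ 2 / 6) + 1) := by
    have h1 : (fun n : ℕ => w2 c n) =
        fun n : ℕ => c * (1 / (n : ℝ) ^ 2) + if n = 0 then 1 else 0 := by
      funext n
      rcases eq_or_ne n 0 with rfl | hn
      · simp [w2]
      · simp [w2, hn, one_div]
    rw [h1]
    exact (hasSum_zeta_two.mul_left c).add (hasSum_ite_eq 0 1)
  have hB : HasSum (fun n : ℕ => w2 c (-(n + 1 : ℤ))) (c * (π ^ 2 / 6)) := by
    have h := (hasSum_nat_add_iff' 1).2 hasSum_zeta_two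
    simp only [Finset.sum_range_one, Nat.cast_zero, ne_eq, OfNat.ofNat_ne_zero,
      not_false_eq_true, zero_pow, div_zero, sub_zero] at h
    have he : (fun n : ℕ => w2 c (-(n + 1 : ℤ))) =
        fun n : ℕ => c * (1 / ((n + 1 : ℕ) : ℝ) ^ 2) := by
      funext n
      have hne : (-(n + 1 : ℤ)) ≠ 0 := by omega
      simp only [w2, hne, if_false, one_div]
      push_cast
      ring
    rw [he]
    exact h.mul_left c
  have := hA.of_nat_of_neg_add_one hB
  convert this using 1
  ring

/-- `‖w_c‖` is summable. [folklore] -/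
theorem summable_norm_w2 (c : ℝ) : Summable fun n => ‖w2 c n‖ := by
  simpa only [Real.norm_eq_abs] using (hasSum_w2 c).summable.abs

/-- `Σ w_c ≤ 1 + 2c·(1654/1000)` (`π < 3.15`). [folklore] -/
theorem tsum_w2_le {c : ℝ} (hc : 0 ≤ c) : ∑' n, w2 c n ≤ 1 + 2 * c * (1654 / 1000) := by
  rw [(hasSum_w2 c).tsum_eq]
  have hπ := Real.pi_lt_d2
  have h2 : π ^ 2 < (3.15 : ℝ) ^ 2 := by gcongr
  have h6 : π ^ 2 / 6 ≤ 1654 / 1000 := by norm_num at h2 ⊢; linarith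
  have : 0 ≤ 2 * c := by positivity
  nlinarith

/-- In-plane weight constant `4/(3a₀²)`, height weight constant `h₀⁻²`, slab constants
`K₁ = 16/(9a₀⁴)`, `K₂ = h₀⁻⁴`. [folklore] -/
def cA : ℝ := 4 / (3 * a₀ ^ 2)

/-- `h₀⁻²`. [folklore] -/
def cH : ℝ := (h₀ ^ 2)⁻¹

/-- The far-field majorant: `i`-slab + `j`-slab + `m`-slab. [folklore] -/
def Bmaj3 (n : ℤ × ℤ × ℤ) : ℝ :=
  cA ^ 2 * (t4 n.1 * (w2 cA n.2.1 * w2 cH n.2.2)) +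
    cA ^ 2 * (w2 cA n.1 * (t4 n.2.1 * w2 cH n.2.2)) +
    cH ^ 2 * (w2 cA n.1 * (w2 cA n.2.1 * t4 n.2.2))

/-- Positivity of the constants. [folklore] -/
theorem cA_pos : 0 < cA ∧ 0 < cH := by
  unfold cA cH h₀ a₀; norm_num

/-- The majorant is `≥ 0` termwise, part by part. [folklore] -/
theorem Bmaj3_parts_nonneg (n : ℤ × ℤ × ℤ) :
    0 ≤ cA ^ 2 * (t4 n.1 * (w2 cA n.2.1 * w2 cH n.2.2)) ∧
      0 ≤ cA ^ 2 * (w2 cA n.1 * (t4 n.2.1 * w2 cH n.2.2)) ∧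
        0 ≤ cH ^ 2 * (w2 cA n.1 * (w2 cA n.2.1 * t4 n.2.2)) := by
  have hA := w2_nonneg cA_pos.1.le
  have hH := w2_nonneg cA_pos.2.le
  exact ⟨by have := t4_nonneg n.1; have := hA n.2.1; have := hH n.2.2; positivity,
    by have := t4_nonneg n.2.1; have := hA n.1; have := hH n.2.2; positivity,
    by have := t4_nonneg n.2.2; have := hA n.1; have := hA n.2.1; positivity⟩

/-- `q⁻¹ ≤ w_{cA}(j)` when `q ≥ 1` and `q ≥ (3a₀²/4)j²`. [folklore] -/
theorem inv_le_w2_cA {q : ℝ} {j : ℤ} (hq1 : 1 ≤ q) (hqj : 3 * a₀ ^ 2 / 4 * (j : ℝ) ^ 2 ≤ q) :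
    q⁻¹ ≤ w2 cA j := by
  unfold w2 cA
  split_ifs with hj
  · exact inv_le_one_of_one_le₀ hq1
  · have hj2 : (0 : ℝ) < (j : ℝ) ^ 2 := by positivity
    have ha : (0 : ℝ) < a₀ ^ 2 := by unfold a₀; norm_num
    rw [show 4 / (3 * a₀ ^ 2) * ((j : ℝ) ^ 2)⁻¹ = (3 * a₀ ^ 2 / 4 * (j : ℝ) ^ 2)⁻¹ by
      field_simp]
    exact inv_anti₀ (by positivity) hqj

/-- `q⁻¹ ≤ w_{cH}(m)` when `q ≥ 1` and `q ≥ h₀²m²`. [folklore] -/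
theorem inv_le_w2_cH {q : ℝ} {m : ℤ} (hq1 : 1 ≤ q) (hqm : (m : ℝ) ^ 2 * h₀ ^ 2 ≤ q) :
    q⁻¹ ≤ w2 cH m := by
  unfold w2 cH
  split_ifs with hm
  · exact inv_le_one_of_one_le₀ hq1
  · have hm2 : (0 : ℝ) < (m : ℝ) ^ 2 := by positivity
    have hh : (0 : ℝ) < h₀ ^ 2 := by unfold h₀ a₀; norm_num
    rw [show (h₀ ^ 2)⁻¹ * ((m : ℝ) ^ 2)⁻¹ = ((m : ℝ) ^ 2 * h₀ ^ 2)⁻¹ by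
      rw [mul_inv, mul_comm]]
    exact inv_anti₀ (by positivity) hqm

/-- `q⁻² ≤ c²·t(i)` when `|i| ≥ 3` and `q ≥ c⁻¹ i²` (`c > 0`). [folklore] -/
theorem inv_sq_le_t4 {q c : ℝ} {i : ℤ} (hc : 0 < c) (hi : 3 ≤ |i|) (hqi : c⁻¹ * (i : ℝ) ^ 2 ≤ q) :
    (q⁻¹) ^ 2 ≤ c ^ 2 * t4 i := by
  unfold t4
  rw [if_pos hi]
  have hi0 : i ≠ 0 := by intro h; rw [h, abs_zero] at hi; norm_num at hi
  have hi2 : (0 : ℝ) < (i : ℝ) ^ 2 := by positivity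
  have hpos : 0 < c⁻¹ * (i : ℝ) ^ 2 := by positivity
  have h1 : q⁻¹ ≤ (c⁻¹ * (i : ℝ) ^ 2)⁻¹ := inv_anti₀ hpos hqi
  have h0 : 0 ≤ q⁻¹ := inv_nonneg.2 (hpos.le.trans hqi)
  calc (q⁻¹) ^ 2 ≤ ((c⁻¹ * (i : ℝ) ^ 2)⁻¹) ^ 2 := pow_le_pow_left₀ h0 h1 2
    _ = c ^ 2 * ((i : ℝ) ^ 4)⁻¹ := by field_simp

/-- `|i| ≥ 3 ⟹ i² ≥ 9` (cast to `ℝ`). [folklore] -/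
theorem nine_le_sq_of_abs {i : ℤ} (hi : 3 ≤ |i|) : (9 : ℝ) ≤ (i : ℝ) ^ 2 := by
  have h : (3 : ℤ) * 3 ≤ |i| * |i| := mul_le_mul hi hi (by norm_num) (abs_nonneg i)
  rw [abs_mul_abs_self] at h
  have h' : (9 : ℤ) ≤ i ^ 2 := by rw [sq]; linarith
  exact_mod_cast h'

/-- Slab lower bounds for `q = ‖Y₀(i,j,m)‖²`: `q ≥ (3a₀²/4)i²`, `(3a₀²/4)j²`, `h₀²m²`, and `q ≥ 4`
outside the block. [folklore] -/
theorem slab_bounds (i j m : ℤ) :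
    3 * a₀ ^ 2 / 4 * (i : ℝ) ^ 2 ≤ ‖Y₀ (i, j, m)‖ ^ 2 ∧
      3 * a₀ ^ 2 / 4 * (j : ℝ) ^ 2 ≤ ‖Y₀ (i, j, m)‖ ^ 2 ∧
      (m : ℝ) ^ 2 * h₀ ^ 2 ≤ ‖Y₀ (i, j, m)‖ ^ 2 ∧
      (3 ≤ |i| ∨ 3 ≤ |j| ∨ 3 ≤ |m| → 4 ≤ ‖Y₀ (i, j, m)‖ ^ 2) := by
  rw [norm_sq_Y₀]
  dsimp only
  have hA2 : a₀ ^ 2 = 2209 / 2500 := by unfold a₀; norm_num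
  have hH2 : h₀ ^ 2 = 3359889 / 6250000 := by unfold h₀ a₀; norm_num
  have hQi := sq_fst_le_Qf (i, j)
  have hQj := sq_snd_le_Qf (i, j)
  dsimp only at hQi hQj
  have hQ0 : (0 : ℝ) ≤ (Qf (i, j) : ℝ) := by nlinarith [sq_nonneg (i : ℝ)]
  have hm2 : (0 : ℝ) ≤ (m : ℝ) ^ 2 := sq_nonneg _
  rw [hA2, hH2]
  refine ⟨by linarith, by linarith, by linarith, ?_⟩
  rintro (hi | hj | hm)
  · have := nine_le_sq_of_abs hi; linarith
  · have := nine_le_sq_of_abs hj; linarith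
  · have := nine_le_sq_of_abs hm; linarith

/-- Outside the block `q⁻⁴` is dominated by the three slab terms. [folklore] -/
theorem inv_pow_four_le_slabs {i j m : ℤ} (hout : 3 ≤ |i| ∨ 3 ≤ |j| ∨ 3 ≤ |m|) :
    ((‖Y₀ (i, j, m)‖ ^ 2)⁻¹) ^ 4 ≤ cA ^ 2 * (t4 i * (w2 cA j * w2 cH m)) +
      cA ^ 2 * (w2 cA i * (t4 j * w2 cH m)) + cH ^ 2 * (w2 cA i * (w2 cA j * t4 m)) := by
  obtain ⟨hB1, hB2, hB3⟩ := Bmaj3_parts_nonneg (i, j, m)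
  dsimp only at hB1 hB2 hB3
  obtain ⟨hqi, hqj, hqm, h4⟩ := slab_bounds i j m
  have hq4 := h4 hout
  set q : ℝ := ‖Y₀ (i, j, m)‖ ^ 2
  have hq1 : 1 ≤ q := by linarith
  have hi0 : 0 ≤ q⁻¹ := inv_nonneg.2 (by linarith)
  have hwA := w2_nonneg cA_pos.1.le
  have e4 : (q⁻¹) ^ 4 = (q⁻¹) ^ 2 * (q⁻¹ * q⁻¹) := by ring
  rw [e4]
  have hcAinv : cA⁻¹ = 3 * a₀ ^ 2 / 4 := by unfold cA; rw [inv_div]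
  rcases hout with hi | hj | hm
  · have h1 : (q⁻¹) ^ 2 ≤ cA ^ 2 * t4 i := inv_sq_le_t4 cA_pos.1 hi (by rw [hcAinv]; exact hqi)
    have h2 : q⁻¹ * q⁻¹ ≤ w2 cA j * w2 cH m :=
      mul_le_mul (inv_le_w2_cA hq1 hqj) (inv_le_w2_cH hq1 hqm) hi0 (hwA j)
    have h3 := mul_le_mul h1 h2 (by positivity) (by have := t4_nonneg i; positivity)
    calc (q⁻¹) ^ 2 * (q⁻¹ * q⁻¹) ≤ cA ^ 2 * t4 i * (w2 cA j * w2 cH m) := h3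
      _ = cA ^ 2 * (t4 i * (w2 cA j * w2 cH m)) := by ring
      _ ≤ _ := by linarith
  · have h1 : (q⁻¹) ^ 2 ≤ cA ^ 2 * t4 j := inv_sq_le_t4 cA_pos.1 hj (by rw [hcAinv]; exact hqj)
    have h2 : q⁻¹ * q⁻¹ ≤ w2 cA i * w2 cH m :=
      mul_le_mul (inv_le_w2_cA hq1 hqi) (inv_le_w2_cH hq1 hqm) hi0 (hwA i)
    have h3 := mul_le_mul h1 h2 (by positivity) (by have := t4_nonneg j; positivity)
    calc (q⁻¹) ^ 2 * (q⁻¹ * q⁻¹) ≤ cA ^ 2 * t4 j * (w2 cA i * w2 cH m) := h3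
      _ = cA ^ 2 * (w2 cA i * (t4 j * w2 cH m)) := by ring
      _ ≤ _ := by linarith
  · have hcH : cH⁻¹ * (m : ℝ) ^ 2 = (m : ℝ) ^ 2 * h₀ ^ 2 := by unfold cH; rw [inv_inv, mul_comm]
    have h1 : (q⁻¹) ^ 2 ≤ cH ^ 2 * t4 m := inv_sq_le_t4 cA_pos.2 hm (by rw [hcH]; exact hqm)
    have h2 : q⁻¹ * q⁻¹ ≤ w2 cA i * w2 cA j :=
      mul_le_mul (inv_le_w2_cA hq1 hqi) (inv_le_w2_cA hq1 hqj) hi0 (hwA i)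
    have h3 := mul_le_mul h1 h2 (by positivity) (by have := t4_nonneg m; positivity)
    calc (q⁻¹) ^ 2 * (q⁻¹ * q⁻¹) ≤ cH ^ 2 * t4 m * (w2 cA i * w2 cA j) := h3
      _ = cH ^ 2 * (w2 cA i * (w2 cA j * t4 m)) := by ring
      _ ≤ _ := by linarith

/-- **Far-field domination:** `Tfar ≤ Bmaj3` termwise. [folklore] -/
theorem Tfar_le_Bmaj3 (n : ℤ × ℤ × ℤ) : Tfar n ≤ Bmaj3 n := by
  obtain ⟨i, j, m⟩ := n
  obtain ⟨hB1, hB2, hB3⟩ := Bmaj3_parts_nonneg (i, j, m)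
  dsimp only at hB1 hB2 hB3
  show Tfar (i, j, m) ≤ cA ^ 2 * (t4 i * (w2 cA j * w2 cH m)) +
      cA ^ 2 * (w2 cA i * (t4 j * w2 cH m)) + cH ^ 2 * (w2 cA i * (w2 cA j * t4 m))
  unfold Tfar
  by_cases h : ((i, j, m) : ℤ × ℤ × ℤ) = 0 ∨ ((i, j, m) : ℤ × ℤ × ℤ) ∈ blockFin
  · rw [if_pos h]; linarith
  rw [if_neg h]
  push Not at h
  obtain ⟨hn0, hnb⟩ := h
  have hout : 3 ≤ |i| ∨ 3 ≤ |j| ∨ 3 ≤ |m| := by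
    by_contra hc
    push Not at hc
    obtain ⟨hi, hj, hm⟩ := hc
    rw [abs_lt] at hi hj hm
    apply hnb
    simp only [blockFin, Finset.mem_erase, Finset.mem_product, Finset.mem_Icc]
    exact ⟨hn0, ⟨by omega, by omega⟩, ⟨by omega, by omega⟩, by omega, by omega⟩
  have hY : Y₀ (i, j, m) ≠ 0 := Y₀_ne_zero hn0
  rw [hx, if_neg hY, Hess₀_ex₁_eq hY]
  have hq4 : 4 ≤ ‖Y₀ (i, j, m)‖ ^ 2 := (slab_bounds i j m).2.2.2 hout
  have hpq : (Y₀ (i, j, m) 0) ^ 2 ≤ ‖Y₀ (i, j, m)‖ ^ 2 := by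
    rw [EuclideanSpace.norm_sq_eq, Fin.sum_univ_three]
    simp only [Real.norm_eq_abs, sq_abs]
    nlinarith [sq_nonneg (Y₀ (i, j, m) 1), sq_nonneg (Y₀ (i, j, m) 2)]
  exact (TQ_le (sq_nonneg _) hpq hq4).trans (inv_pow_four_le_slabs hout)

/-- Products of three absolutely summable weights are summable over `ℤ³` with the product sum.
[folklore] -/
theorem hasSum_mul3 {f g k : ℤ → ℝ} (hf : Summable fun n => ‖f n‖) (hg : Summable fun n => ‖g n‖)
    (hk : Summable fun n => ‖k n‖) :
    HasSum (fun n : ℤ × ℤ × ℤ => f n.1 * (g n.2.1 * k n.2.2))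
      ((∑' n, f n) * ((∑' n, g n) * ∑' n, k n)) := by
  have hgk : Summable fun p : ℤ × ℤ => ‖g p.1 * k p.2‖ := hg.mul_norm hk
  rw [tsum_mul_tsum_of_summable_norm hg hk, tsum_mul_tsum_of_summable_norm hf hgk]
  exact (summable_mul_of_summable_norm hf hgk).hasSum

/-- The majorant is summable with an explicit sum. [folklore] -/
theorem hasSum_Bmaj3 : HasSum Bmaj3
    (cA ^ 2 * ((∑' n, t4 n) * ((∑' n, w2 cA n) * ∑' n, w2 cH n)) +
      cA ^ 2 * ((∑' n, w2 cA n) * ((∑' n, t4 n) * ∑' n, w2 cH n)) +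
      cH ^ 2 * ((∑' n, w2 cA n) * ((∑' n, w2 cA n) * ∑' n, t4 n))) := by
  have hA := summable_norm_w2 cA
  have hH := summable_norm_w2 cH
  exact (((hasSum_mul3 summable_norm_t4 hA hH).mul_left _).add
    ((hasSum_mul3 hA summable_norm_t4 hH).mul_left _)).add
    ((hasSum_mul3 hA hA summable_norm_t4).mul_left _)

/-- **The far field is at most `21`.** [folklore] -/
theorem tsum_Bmaj3_le : ∑' n, Bmaj3 n ≤ 21 := by
  rw [hasSum_Bmaj3.tsum_eq]
  have ht := tsum_t4_le
  have ht0 : 0 ≤ ∑' n, t4 n := tsum_nonneg t4_nonneg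
  have hwA := tsum_w2_le cA_pos.1.le
  have hwH := tsum_w2_le cA_pos.2.le
  have hwA0 : 0 ≤ ∑' n, w2 cA n := tsum_nonneg (w2_nonneg cA_pos.1.le)
  have hwH0 : 0 ≤ ∑' n, w2 cH n := tsum_nonneg (w2_nonneg cA_pos.2.le)
  have hcA : cA ≤ 151 / 100 := by unfold cA a₀; norm_num
  have hcH : cH ≤ 187 / 100 := by unfold cH h₀ a₀; norm_num
  have hcA0 := cA_pos.1.le
  have hcH0 := cA_pos.2.le
  set T := ∑' n, t4 n
  set WA := ∑' n, w2 cA n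
  set WH := ∑' n, w2 cH n
  have hWA : WA ≤ 6 := by nlinarith
  have hWH : WH ≤ 72 / 10 := by nlinarith
  have h1 : cA ^ 2 * (T * (WA * WH)) ≤ (151 / 100) ^ 2 * (63 / 1000 * (6 * (72 / 10))) := by
    gcongr
  have h2 : cA ^ 2 * (WA * (T * WH)) ≤ (151 / 100) ^ 2 * (6 * (63 / 1000 * (72 / 10))) := by
    gcongr
  have h3 : cH ^ 2 * (WA * (WA * T)) ≤ (187 / 100) ^ 2 * (6 * (6 * (63 / 1000))) := by
    gcongr
  linarith

/-! ### Summability of the row function and the sign of the second variation -/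

/-- The full row function is absolutely summable over the labels (`|e₁ᵀK(y)e₁| ≤ 904‖y‖⁻⁸` on the
lattice). [folklore] -/
theorem summable_hx_Y₀ : Summable fun n : ℤ × ℤ × ℤ => hx (Y₀ n) := by
  set L := shLat a₀_ne_zero'.1 a₀_ne_zero'.2
  let φ : ℤ × ℤ × ℤ → L := fun n => ⟨Y₀ n, Y₀_mem n⟩
  have hφ : Function.Injective φ := fun n n' h =>
    Y₀_injective (congrArg (fun y : L => (y : E3)) h)
  have h8 := ZLattice.summable_norm_sub_inv_pow L 8 (by rw [finrank_shLat]; norm_num) 0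
  have h8' := (h8.comp_injective hφ).mul_left 904
  refine Summable.of_norm_bounded h8' fun n => ?_
  rw [Real.norm_eq_abs]
  simp only [Function.comp, φ, sub_zero]
  unfold hx
  split_ifs with h0
  · rw [abs_zero]; positivity
  · exact abs_Hess₀_le_inv_pow (half_le_norm_Y₀ h0) norm_ex₁

/-- **The second variation of `e₁·𝟙_{0}` on the AAA lattice is negative:**
`Σ'_n e₁ᵀK(Y₀ n)e₁ < −75.8 + 21 < 0`. [folklore] -/
theorem tsum_hx_Y₀_neg : ∑' n : ℤ × ℤ × ℤ, hx (Y₀ n) < 0 := by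
  obtain ⟨S, hS, hSlt⟩ := hasSum_Tnear
  have hfar : Summable Tfar := by
    have := summable_hx_Y₀.sub hS.summable
    refine this.congr fun n => ?_
    rw [hx_eq_add]; ring
  have hsplit : ∑' n : ℤ × ℤ × ℤ, hx (Y₀ n) = S + ∑' n, Tfar n := by
    rw [← hS.tsum_eq, ← hS.summable.tsum_add hfar]
    exact tsum_congr hx_eq_add
  have hle : ∑' n, Tfar n ≤ ∑' n, Bmaj3 n :=
    Summable.tsum_le_tsum Tfar_le_Bmaj3 hfar hasSum_Bmaj3.summable
  linarith [tsum_Bmaj3_le]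

/-- Reindexing the lattice row sum by labels. [folklore] -/
theorem tsum_Hrow_shLat_eq :
    ∑' y : shLat a₀_ne_zero'.1 a₀_ne_zero'.2, Hrow (shLat a₀_ne_zero'.1 a₀_ne_zero'.2) ex₁ y =
      ∑' n : ℤ × ℤ × ℤ, hx (Y₀ n) := by
  set L := shLat a₀_ne_zero'.1 a₀_ne_zero'.2
  let φ : ℤ × ℤ × ℤ → L := fun n => ⟨Y₀ n, Y₀_mem n⟩
  have hφ : Function.Injective φ := fun n n' h =>
    Y₀_injective (congrArg (fun y : L => (y : E3)) h)
  have hsupp : Function.support (Hrow L ex₁) ⊆ Set.range φ := by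
    intro y _
    obtain ⟨n, hn⟩ := exists_Y₀_eq y.2
    exact ⟨n, Subtype.ext hn⟩
  rw [← hφ.tsum_eq hsupp]
  refine tsum_congr fun n => ?_
  simp only [Hrow, hx, φ, Submodule.mk_eq_zero]

/-- **The Hägg condition is load-bearing.**  On the window `47/50 ≤ a ∧ a ≤ 1 ∧ HeightBox a z`
with NO condition on the word `s` (the crux's `Box` with `IsHaggSeq s` deleted), uniform polytype
stability FAILS: the zero word `s ≡ 0` (`haggLabel ≡ 0`, every layer in registry `A`, i.e. the
simple-hexagonal AAA stacking) at `a = 47/50` and uniform heights `h₀·m`, `h₀ = 39a/50 = 0.7332`,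
is in the window and force balanced (a Bravais lattice, part I), but its VERTICAL bonds have
length `h₀ < 1` and are compressed: for `u = e₁·𝟙_{0}`, `½·hessForm = Σ_{y≠0} e₁ᵀK(y)e₁ < 0`
(near field `|n|_∞ ≤ 2` evaluated exactly over `ℚ` by the kernel: `−75.86`, of which the two
vertical bonds give `2V′(h₀)/h₀ = −130.19` and the six in-plane bonds `+56.08`; far field
`≤ q⁻⁴ ≤` three slab majorants summed with `ζ(2)`, `ζ(4)`, `π < 3.15`: `≤ 21`), while
`κ·nnForm ≥ 0`. [folklore] -/
theorem uniformPolytypeStability_false_without_hagg :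
    ¬ UniformPolytypeStabilityOn fun a _ z => 47 / 50 ≤ a ∧ a ≤ 1 ∧ HeightBox a z := by
  rintro ⟨κ, hκ, h⟩
  set L := shLat a₀_ne_zero'.1 a₀_ne_zero'.2
  have hS : Sites a₀ 0 (zU h₀) = (L : Set E3) := sites_zero_zU a₀_ne_zero'.1 a₀_ne_zero'.2
  have hW : 47 / 50 ≤ a₀ ∧ a₀ ≤ 1 ∧ HeightBox a₀ (zU h₀) := by
    refine ⟨by unfold a₀; norm_num, by unfold a₀; norm_num, heightBox_zU ?_ ?_⟩
    · unfold h₀; linarith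
    · unfold h₀ a₀; norm_num
  have hF : ForceBalanced a₀ 0 (zU h₀) := forceBalanced_of_sites_eq L (finrank_shLat _ _) hS
  have hsupp : Function.support (uS ex₁) ⊆ Sites a₀ 0 (zU h₀) :=
    (support_uS ex₁).trans (by
      intro p hp
      rw [Set.mem_singleton_iff] at hp
      subst hp
      rw [hS]
      exact L.zero_mem)
  have hmin : ∀ y ∈ L, y ≠ 0 → (1 / 2 : ℝ) ≤ ‖y‖ := by
    intro y hy hy0
    obtain ⟨n, rfl⟩ := exists_Y₀_eq hy
    exact half_le_norm_Y₀ hy0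
  have key := h a₀ 0 (zU h₀) hW hF (uS ex₁) (finite_support_uS ex₁) hsupp
  rw [hessForm_single L (finrank_shLat _ _) hS hmin norm_ex₁, tsum_Hrow_shLat_eq] at key
  have hnn := mul_nonneg hκ.le (nnForm_nonneg a₀ 0 (zU h₀) (uS ex₁))
  linarith [tsum_hx_Y₀_neg]

end HaggFar

end Summit.AtomisticToContinuum.Crystallization.Theorems.UniformPolytypeStabilityNegative

end
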